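import Literature.NumberTheory.DiophantineGeometry.SumsOfUnitsSquareProofs
import Literature.NumberTheory.DiophantineGeometry.OptimizedSimplifiedHeightBoundsProofs
import HarnessLib

/-!
# von Känel–Matschke, Corollary 9.3 (ii) (pairs of `S`-units whose sum is a cube) and Corollary 9.3 from the
# §10 roots (proofs)

Topic `Literature/NumberTheory/DiophantineGeometry` (family `abc`). A proofs-only companion (theorems only; NO
definition, NO new named fact; D-0014, D-0026) of `MordellThueRamanujanNagellHeightBounds.lean`
(`corollary_9_3_sim`, R. von Känel, B. Matschke, arXiv:1605.06079 = Mem. AMS 286 (2023) [`VonkanelMatschke2023`],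
Cor. 9.3 with `Ω' = 3Ω_sim(1, S) + 9 log N_S`). Part (i) is `SumsOfUnitsSquareProofs.lean`.

## The printed proof of (ii) (§9) and how it is followed

*"there is `δ ∈ 𝒪^×` such that `δ³u` and `δ³v` are in `ℤ`, with `δ³u + δ³v` a perfect cube and `gcd(δ³u, δ³v)`
cube-free"* — `exists_isSUnit_cube_mul_pair`. *"(claimcube) If `m, n` are in `ℤ ∩ 𝒪^×` with `m + n` a perfect cube
and `gcd(m, n)` cube-free, then `h(n) ≤ Ω`. To prove this claim we take `l ∈ ℤ` with `l³ = m + n` and we write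
`m = m'³m₀` with `m', m₀ ∈ ℤ` such that `m₀ ∣ N_S²` [`exists_cube_mul_of_isSUnit_int`]. Further we define `x = l/m'`
and `y = n/m'³`. Then `(x, y)` lies in `𝒪 × 𝒪^×` and satisfies `x³ − m₀ = y`. On writing `y = wy'²` with `y' ∈ 𝒪^×`
and `w ∈ ℤ` dividing `N_S` [`exists_eq_int_mul_sq_of_isSUnit`], we see that `(xw, y'w²)` is a solution of the
Mordell equation (1.2) with parameter `a = −m₀w³`. Here `a ∈ ℤ` is nonzero. Thus on using that `gcd(m, n)` is
cube-free, we see that Proposition 10.7 implies our claim"* — `claimcube`, with the Mordell bound in the form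
Prop. 10.1 (`mordell_height_le`, `Ω_sim`): `Ω_sim(a, S) = (1/3)h(a) + Ω_sim(1, S)`, `h(a) ≤ 5 log N_S`,
`h(y) ≤ 2h(y'w²) + 3h(w) ≤ 3Ω_sim(1, S) + 8 log N_S`, and `h(n) ≤ h(y)` by `gcd(n, m') = 1` (from cube-freeness).
*"Finally we deduce (ii) by applying (claimcube) with `m = δ³u` and `n = δ³v`"* —
`corollary_9_3_ii_of_mordell_height_le`.

## Main result

`corollary_9_3_sim_of_roots (hmod) (h103) (hi) : corollary_9_3_sim` — from {modularity, Lemma 10.3, Prop. 10.8 (i)}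
via `corollary_9_1_sim_of_roots` and `mordell_height_le_of_lemma_10_3_of_prop_10_8_i`. No `abc` claim; axioms
standard.
-/

noncomputable section

open Height
open Literature.NumberTheory.EllipticCurves.ModularForms

namespace Literature.NumberTheory.DiophantineGeometry

namespace VonKanelMatschke

/-- Integers have `ord_p ≥ 0`. [folklore] -/
private theorem padicValRat_intCast_nonneg' (p : ℕ) (z : ℤ) : 0 ≤ padicValRat p (z : ℚ) := by
  rw [padicValRat.of_int]; exact_mod_cast Nat.zero_le _

/-- `h(n) = log|n|` for a nonzero integer. [folklore] -/
private theorem logHeight₁_intCast_eq' {n : ℤ} (hn : n ≠ 0) : logHeight₁ (n : ℚ) = Real.log |(n : ℝ)| := by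
  rw [Rat.logHeight₁_eq_log_max]
  have h1 : 1 ≤ n.natAbs := Nat.one_le_iff_ne_zero.mpr (Int.natAbs_ne_zero.mpr hn)
  simp [max_eq_left h1, Nat.cast_natAbs, Int.cast_abs]

/-! ### `δ³u, δ³v ∈ ℤ` with cube-free gcd -/

/-- **The normalisation of the proof of Cor. 9.3 (ii)**: `δ = ∏_{p ∈ S} p^{−⌊min(ord_p u, ord_p v)/3⌋}` gives
`δ³u, δ³v ∈ ℤ ∩ 𝒪^×` with `gcd(δ³u, δ³v)` cube-free. [cite: VonkanelMatschke2023, §9 (proof of Cor. 9.3 (ii))] -/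
theorem exists_isSUnit_cube_mul_pair {S : Finset ℕ} (hS : ∀ p ∈ S, p.Prime) {u v : ℚ}
    (hu : IsSUnit S u) (hv : IsSUnit S v) :
    ∃ (δ : ℚ) (m n : ℤ), IsSUnit S δ ∧ δ ^ 3 * u = m ∧ δ ^ 3 * v = n ∧
      IsSUnit S (m : ℚ) ∧ IsSUnit S (n : ℚ) ∧ ∀ p : ℕ, p.Prime → ¬ ((p : ℤ) ^ 3 ∣ m ∧ (p : ℤ) ^ 3 ∣ n) := by
  classical
  have hu0 := hu.1
  have hv0 := hv.1
  set e : ℕ → ℤ := fun p => min (padicValRat p u) (padicValRat p v) / 3 with he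
  set δ : ℚ := ∏ ℓ ∈ S, (ℓ : ℚ) ^ (-e ℓ) with hδdef
  have hδ0 : δ ≠ 0 :=
    Finset.prod_ne_zero_iff.mpr fun ℓ hℓ => zpow_ne_zero _ (by exact_mod_cast (hS ℓ hℓ).ne_zero)
  have hvδ : ∀ p : ℕ, p.Prime → padicValRat p δ = if p ∈ S then -e p else 0 := by
    intro p hp
    haveI : Fact p.Prime := ⟨hp⟩
    exact padicValRat_prod_natCast_zpow hS (fun ℓ => -e ℓ) p
  have hδS : IsSUnit S δ := isSUnit_of_padicValRat_eq_zero hδ0 fun p hp hpS => by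
    rw [hvδ p hp, if_neg hpS]
  have hval : ∀ w : ℚ, w ≠ 0 → ∀ p : ℕ, p.Prime →
      padicValRat p (δ ^ 3 * w) = 3 * padicValRat p δ + padicValRat p w := by
    intro w hw p hp
    haveI : Fact p.Prime := ⟨hp⟩
    rw [padicValRat.mul (pow_ne_zero 3 hδ0) hw, padicValRat.pow]; push_cast; ring
  have hrem : ∀ p ∈ S, 0 ≤ min (padicValRat p u) (padicValRat p v) - 3 * e p ∧
      min (padicValRat p u) (padicValRat p v) - 3 * e p ≤ 2 := by
    intro p hp
    have h1 := Int.emod_add_mul_ediv (min (padicValRat p u) (padicValRat p v)) 3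
    have h2 := Int.emod_nonneg (min (padicValRat p u) (padicValRat p v)) (by norm_num : (3 : ℤ) ≠ 0)
    have h3 := Int.emod_lt_of_pos (min (padicValRat p u) (padicValRat p v)) (by norm_num : (0 : ℤ) < 3)
    rw [he]; dsimp only; constructor <;> omega
  have hnonneg : ∀ w : ℚ, IsSUnit S w → (∀ p, min (padicValRat p u) (padicValRat p v) ≤ padicValRat p w) →
      ∀ p : ℕ, p.Prime → 0 ≤ padicValRat p (δ ^ 3 * w) := by
    intro w hw hmin p hp
    rw [hval w hw.1 p hp, hvδ p hp]
    split_ifs with hpS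
    · have := hrem p hpS; have := hmin p; omega
    · rw [padicValRat_eq_zero_of_isSUnit hw hp hpS]; simp
  have hmu : ∀ p, min (padicValRat p u) (padicValRat p v) ≤ padicValRat p u := fun p => min_le_left _ _
  have hmv : ∀ p, min (padicValRat p u) (padicValRat p v) ≤ padicValRat p v := fun p => min_le_right _ _
  obtain ⟨m, hm⟩ := exists_intCast_of_padicValRat_nonneg (hnonneg u hu hmu)
  obtain ⟨n, hn⟩ := exists_intCast_of_padicValRat_nonneg (hnonneg v hv hmv)
  have hunitS : ∀ w : ℚ, IsSUnit S w → IsSUnit S (δ ^ 3 * w) := fun w hw =>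
    isSUnit_of_padicValRat_eq_zero (mul_ne_zero (pow_ne_zero 3 hδ0) hw.1) fun p hp hpS => by
      rw [hval w hw.1 p hp, hvδ p hp, if_neg hpS, padicValRat_eq_zero_of_isSUnit hw hp hpS]; simp
  refine ⟨δ, m, n, hδS, hm, hn, hm ▸ hunitS u hu, hn ▸ hunitS v hv, fun p hp ⟨hpm, hpn⟩ => ?_⟩
  haveI : Fact p.Prime := ⟨hp⟩
  have hm0 : m ≠ 0 := by
    have : (m : ℚ) ≠ 0 := hm ▸ mul_ne_zero (pow_ne_zero 3 hδ0) hu0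
    exact_mod_cast this
  have hn0 : n ≠ 0 := by
    have : (n : ℚ) ≠ 0 := hn ▸ mul_ne_zero (pow_ne_zero 3 hδ0) hv0
    exact_mod_cast this
  have h3m : (3 : ℤ) ≤ padicValRat p (δ ^ 3 * u) := by
    rw [hm, padicValRat.of_int]
    rcases (padicValInt_dvd_iff 3 m).mp hpm with h | h
    · exact absurd h hm0
    · exact_mod_cast h
  have h3n : (3 : ℤ) ≤ padicValRat p (δ ^ 3 * v) := by
    rw [hn, padicValRat.of_int]
    rcases (padicValInt_dvd_iff 3 n).mp hpn with h | h
    · exact absurd h hn0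
    · exact_mod_cast h
  rw [hval u hu0 p hp, hvδ p hp] at h3m
  rw [hval v hv0 p hp, hvδ p hp] at h3n
  by_cases hpS : p ∈ S
  · rw [if_pos hpS] at h3m h3n
    have := hrem p hpS
    rcases min_choice (padicValRat p u) (padicValRat p v) with h | h <;> omega
  · rw [if_neg hpS, padicValRat_eq_zero_of_isSUnit hu hp hpS] at h3m
    simp at h3m

/-! ### `m = m'³ m₀` with `m₀ ∣ N_S²`, and `y = w y'²` with `w ∣ N_S` -/

/-- *"we write `m = m'³m₀` with `m', m₀ ∈ ℤ` such that `m₀ ∣ N_S²`"* (for `m ∈ ℤ ∩ 𝒪^×`; `m' = ∏_{p∈S} p^{⌊ord_p m/3⌋} > 0`,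
`ord_p(m₀) ∈ {0, 1, 2}`, so `h(m₀) ≤ 2 log N_S`). [cite: VonkanelMatschke2023, §9 (proof of Cor. 9.3 (ii))] -/
theorem exists_cube_mul_of_isSUnit_int {S : Finset ℕ} (hS : ∀ p ∈ S, p.Prime) {m : ℤ} (hm : IsSUnit S (m : ℚ)) :
    ∃ M m₀ : ℤ, 0 < M ∧ m = M ^ 3 * m₀ ∧ IsSUnit S (M : ℚ) ∧ IsSUnit S (m₀ : ℚ) ∧
      logHeight₁ (m₀ : ℚ) ≤ 2 * Real.log (primesProd S) := by
  classical
  have hm0 : (m : ℚ) ≠ 0 := hm.1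
  set q : ℕ → ℤ := fun p => padicValRat p (m : ℚ) / 3 with hq
  set Mq : ℚ := ∏ ℓ ∈ S, (ℓ : ℚ) ^ q ℓ with hMq
  have hMqpos : 0 < Mq :=
    Finset.prod_pos fun ℓ hℓ => zpow_pos (by exact_mod_cast (hS ℓ hℓ).pos) _
  have hMq0 : Mq ≠ 0 := hMqpos.ne'
  have hvM : ∀ p : ℕ, p.Prime → padicValRat p Mq = if p ∈ S then q p else 0 := by
    intro p hp
    haveI : Fact p.Prime := ⟨hp⟩
    exact padicValRat_prod_natCast_zpow hS q p
  have hq0 : ∀ p, 0 ≤ q p := fun p => by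
    rw [hq]; exact Int.ediv_nonneg (padicValRat_intCast_nonneg' p m) (by norm_num)
  have hMS : IsSUnit S Mq := isSUnit_of_padicValRat_eq_zero hMq0 fun p hp hpS => by
    rw [hvM p hp, if_neg hpS]
  obtain ⟨M, hM⟩ := exists_intCast_of_padicValRat_nonneg (x := Mq) fun p hp => by
    rw [hvM p hp]; split_ifs <;> simp [hq0 p]
  set m₀q : ℚ := (m : ℚ) / Mq ^ 3 with hm₀q
  have hm₀q0 : m₀q ≠ 0 := div_ne_zero hm0 (pow_ne_zero 3 hMq0)
  have hvm₀ : ∀ p : ℕ, p.Prime → padicValRat p m₀q = padicValRat p (m : ℚ) - 3 * padicValRat p Mq := by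
    intro p hp
    haveI : Fact p.Prime := ⟨hp⟩
    rw [hm₀q, padicValRat.div hm0 (pow_ne_zero 3 hMq0), padicValRat.pow]; push_cast; ring
  have hr : ∀ p ∈ S, padicValRat p m₀q ≤ (2 : ℕ) ∧ -((2 : ℕ) : ℤ) ≤ padicValRat p m₀q := by
    intro p hp
    rw [hvm₀ p (hS p hp), hvM p (hS p hp), if_pos hp, hq]
    dsimp only
    have h1 := Int.emod_add_mul_ediv (padicValRat p (m : ℚ)) 3
    have h2 := Int.emod_nonneg (padicValRat p (m : ℚ)) (by norm_num : (3 : ℤ) ≠ 0)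
    have h3 := Int.emod_lt_of_pos (padicValRat p (m : ℚ)) (by norm_num : (0 : ℤ) < 3)
    push_cast
    constructor <;> omega
  have hm₀S : IsSUnit S m₀q := isSUnit_of_padicValRat_eq_zero hm₀q0 fun p hp hpS => by
    rw [hvm₀ p hp, hvM p hp, if_neg hpS, padicValRat_eq_zero_of_isSUnit hm hp hpS]; ring
  obtain ⟨m₀, hm₀⟩ := exists_intCast_of_padicValRat_nonneg (x := m₀q) fun p hp => by
    by_cases hpS : p ∈ S
    · have h0 := hvm₀ p hp
      rw [hvM p hp, if_pos hpS] at h0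
      have h1 := Int.emod_add_mul_ediv (padicValRat p (m : ℚ)) 3
      have h2 := Int.emod_nonneg (padicValRat p (m : ℚ)) (by norm_num : (3 : ℤ) ≠ 0)
      rw [h0, hq]; dsimp only; omega
    · rw [hvm₀ p hp, hvM p hp, if_neg hpS, padicValRat_eq_zero_of_isSUnit hm hp hpS]; simp
  have hMpos : 0 < M := by have : (0 : ℚ) < M := hM ▸ hMqpos; exact_mod_cast this
  refine ⟨M, m₀, hMpos, ?_, hM ▸ hMS, hm₀ ▸ hm₀S, ?_⟩
  · have : (m : ℚ) = (M : ℚ) ^ 3 * m₀ := by rw [← hM, ← hm₀, hm₀q]; field_simp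
    exact_mod_cast this
  · have := logHeight₁_le_mul_log_primesProd hS hm₀S 2 (fun p hp => (hr p hp).1) (fun p hp => (hr p hp).2)
    rw [← hm₀]; exact_mod_cast this

/-- *"writing `y = wy'²` with `y' ∈ 𝒪^×` and `w ∈ ℤ` dividing `N_S`"* (`y ∈ 𝒪^×`; `y' = ∏_{p∈S} p^{⌊ord_p y/2⌋}`,
`ord_p(w) ∈ {0, 1}`, `h(w) ≤ log N_S`). [cite: VonkanelMatschke2023, §9 (proof of Cor. 9.3 (ii))] -/
theorem exists_eq_int_mul_sq_of_isSUnit {S : Finset ℕ} (hS : ∀ p ∈ S, p.Prime) {y : ℚ} (hy : IsSUnit S y) :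
    ∃ (w : ℤ) (y' : ℚ), IsSUnit S (w : ℚ) ∧ IsSUnit S y' ∧ y = w * y' ^ 2 ∧
      logHeight₁ (w : ℚ) ≤ Real.log (primesProd S) := by
  classical
  have hy0 : y ≠ 0 := hy.1
  set q : ℕ → ℤ := fun p => padicValRat p y / 2 with hq
  set y' : ℚ := ∏ ℓ ∈ S, (ℓ : ℚ) ^ q ℓ with hy'
  have hy'0 : y' ≠ 0 :=
    Finset.prod_ne_zero_iff.mpr fun ℓ hℓ => zpow_ne_zero _ (by exact_mod_cast (hS ℓ hℓ).ne_zero)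
  have hvy' : ∀ p : ℕ, p.Prime → padicValRat p y' = if p ∈ S then q p else 0 := by
    intro p hp
    haveI : Fact p.Prime := ⟨hp⟩
    exact padicValRat_prod_natCast_zpow hS q p
  have hy'S : IsSUnit S y' := isSUnit_of_padicValRat_eq_zero hy'0 fun p hp hpS => by
    rw [hvy' p hp, if_neg hpS]
  set wq : ℚ := y / y' ^ 2 with hwq
  have hwq0 : wq ≠ 0 := div_ne_zero hy0 (pow_ne_zero 2 hy'0)
  have hvw : ∀ p : ℕ, p.Prime → padicValRat p wq = padicValRat p y - 2 * padicValRat p y' := by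
    intro p hp
    haveI : Fact p.Prime := ⟨hp⟩
    rw [hwq, padicValRat.div hy0 (pow_ne_zero 2 hy'0), padicValRat.pow]; push_cast; ring
  have hr : ∀ p ∈ S, padicValRat p wq ≤ 1 ∧ 0 ≤ padicValRat p wq := by
    intro p hp
    rw [hvw p (hS p hp), hvy' p (hS p hp), if_pos hp, hq]
    dsimp only
    have h1 := Int.emod_add_mul_ediv (padicValRat p y) 2
    have h2 := Int.emod_nonneg (padicValRat p y) (by norm_num : (2 : ℤ) ≠ 0)
    have h3 := Int.emod_lt_of_pos (padicValRat p y) (by norm_num : (0 : ℤ) < 2)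
    constructor <;> omega
  have hwS : IsSUnit S wq := isSUnit_of_padicValRat_eq_zero hwq0 fun p hp hpS => by
    rw [hvw p hp, hvy' p hp, if_neg hpS, padicValRat_eq_zero_of_isSUnit hy hp hpS]; ring
  obtain ⟨w, hw⟩ := exists_intCast_of_padicValRat_nonneg (x := wq) fun p hp => by
    by_cases hpS : p ∈ S
    · exact (hr p hpS).2
    · rw [hvw p hp, hvy' p hp, if_neg hpS, padicValRat_eq_zero_of_isSUnit hy hp hpS]; simp
  refine ⟨w, y', hw ▸ hwS, hy'S, ?_, ?_⟩
  · rw [← hw, hwq]; field_simp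
  · rw [← hw]
    exact logHeight₁_le_log_primesProd hS hwS (fun p hp => (hr p hp).1) (fun p hp => by
      have := (hr p hp).2; omega)

/-! ### (claimcube) -/

/-- `Ω_sim(a, S) = (1/3) h(a) + Ω_sim(1, S)` for `a ∈ 𝒪^×` (`a_S = 1_S`). [cite: VonkanelMatschke2023, §9 (Ω = 3Ω_opt(1,S) + 9 log N_S)] -/
theorem omegaSim_of_isSUnit {S : Finset ℕ} {a : ℚ} (h : IsSUnit S a) :
    omegaSim S a = 1 / 3 * logHeight₁ a + omegaSim S 1 := by
  have hlev : mordellLevel S a = mordellLevel S 1 := by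
    rw [show a = a * 1 by ring]; exact mordellLevel_mul_of_isSUnit h one_ne_zero
  simp only [omegaSim, hlev, logHeight₁_one]
  ring

/-- **(claimcube)** (PROVED from Prop. 10.1): *"If `m, n` are in `ℤ ∩ 𝒪^×` with `m + n` a perfect cube and
`gcd(m, n)` cube-free, then `h(n) ≤ Ω`"*, with `Ω' = 3Ω_sim(1, S) + 9 log N_S` (in fact `+ 8 log N_S`).
[cite: VonkanelMatschke2023, §9 (proof of Cor. 9.3 (ii), display (claimcube))] -/
theorem claimcube (hMo : mordell_height_le) {S : Finset ℕ} (hS : ∀ p ∈ S, p.Prime) {m n l : ℤ}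
    (hm : IsSUnit S (m : ℚ)) (hn : IsSUnit S (n : ℚ)) (hl : l ^ 3 = m + n)
    (hcf : ∀ p : ℕ, p.Prime → ¬ ((p : ℤ) ^ 3 ∣ m ∧ (p : ℤ) ^ 3 ∣ n)) :
    logHeight₁ (n : ℚ) ≤ 3 * omegaSim S 1 + 9 * Real.log (primesProd S) := by
  obtain ⟨M, m₀, hMpos, hmeq, hMS, hm₀S, hhm₀⟩ := exists_cube_mul_of_isSUnit_int hS hm
  have hn0 : n ≠ 0 := by have := hn.1; exact_mod_cast this
  have hm₀0 : (m₀ : ℚ) ≠ 0 := hm₀S.1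
  have hMq0 : (M : ℚ) ≠ 0 := hMS.1
  have hlogN : 0 ≤ Real.log (primesProd S) :=
    Real.log_nonneg (by exact_mod_cast one_le_primesProd hS)
  set x : ℚ := (l : ℚ) / M with hx
  set y : ℚ := (n : ℚ) / (M : ℚ) ^ 3 with hy
  have hl' : (l : ℚ) ^ 3 = (M : ℚ) ^ 3 * m₀ + n := by rw [hmeq] at hl; exact_mod_cast hl
  have hxy : x ^ 3 - m₀ = y := by
    rw [hx, hy, div_pow, hl']; field_simp; ring
  -- `x ∈ 𝒪`, `y ∈ 𝒪^×`
  have hxS : IsSInteger S x := by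
    by_cases hl0 : l = 0
    · rw [hx, hl0]; simpa using isSInteger_intCast S 0
    · refine isSInteger_of_padicValRat_nonneg fun p hp hpS => ?_
      haveI : Fact p.Prime := ⟨hp⟩
      rw [hx, padicValRat.div (by exact_mod_cast hl0) hMq0, padicValRat_eq_zero_of_isSUnit hMS hp hpS,
        sub_zero]
      exact padicValRat_intCast_nonneg' p l
  have hy0 : y ≠ 0 := div_ne_zero (by exact_mod_cast hn0) (pow_ne_zero 3 hMq0)
  have hyS : IsSUnit S y := isSUnit_of_padicValRat_eq_zero hy0 fun p hp hpS => by
    haveI : Fact p.Prime := ⟨hp⟩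
    rw [hy, padicValRat.div (by exact_mod_cast hn0) (pow_ne_zero 3 hMq0), padicValRat.pow,
      padicValRat_eq_zero_of_isSUnit hn hp hpS, padicValRat_eq_zero_of_isSUnit hMS hp hpS]; simp
  -- `y = w y'²`, the Mordell equation `Y² = X³ + a`, `X = xw`, `Y = y'w²`, `a = −m₀w³`
  obtain ⟨w, y', hwS, hy'S, hyw, hhw⟩ := exists_eq_int_mul_sq_of_isSUnit hS hyS
  have hw0 : (w : ℚ) ≠ 0 := hwS.1
  set X : ℚ := x * w with hX
  set Y : ℚ := y' * (w : ℚ) ^ 2 with hY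
  set a : ℚ := -(m₀ : ℚ) * (w : ℚ) ^ 3 with ha
  have ha0 : a ≠ 0 := mul_ne_zero (neg_ne_zero.mpr hm₀0) (pow_ne_zero 3 hw0)
  have haS : IsSUnit S a := by
    refine isSUnit_of_padicValRat_eq_zero ha0 fun p hp hpS => ?_
    haveI : Fact p.Prime := ⟨hp⟩
    rw [ha, padicValRat.mul (neg_ne_zero.mpr hm₀0) (pow_ne_zero 3 hw0), padicValRat.neg, padicValRat.pow,
      padicValRat_eq_zero_of_isSUnit hm₀S hp hpS, padicValRat_eq_zero_of_isSUnit hwS hp hpS]; simp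
  have hXY : Y ^ 2 = X ^ 3 + a := by
    have e1 : y' ^ 2 = y / w := by rw [hyw]; field_simp
    rw [hY, hX, ha, mul_pow, e1, ← hxy]; field_simp; ring
  have hXS : IsSInteger S X := isSInteger_mul hxS hwS.isSInteger
  have hYS : IsSInteger S Y := by
    refine isSInteger_of_padicValRat_nonneg fun p hp hpS => ?_
    haveI : Fact p.Prime := ⟨hp⟩
    rw [hY, padicValRat.mul hy'S.1 (pow_ne_zero 2 hw0), padicValRat.pow,
      padicValRat_eq_zero_of_isSUnit hy'S hp hpS, padicValRat_eq_zero_of_isSUnit hwS hp hpS]; simp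
  -- Prop. 10.1: `max(h(X), (2/3)h(Y)) ≤ Ω_sim(a, S) = (1/3)h(a) + Ω_sim(1, S)`, `h(a) ≤ 5 log N_S`
  have hMordell := hMo S hS a ha0 haS.isSInteger X Y hXS hYS hXY
  rw [omegaSim_of_isSUnit haS] at hMordell
  have hha : logHeight₁ a ≤ 5 * Real.log (primesProd S) := by
    have h1 := logHeight₁_mul_le (-(m₀ : ℚ)) ((w : ℚ) ^ 3)
    rw [logHeight₁_neg, logHeight₁_pow] at h1
    rw [ha]; push_cast at h1 ⊢; linarith
  have hY' : logHeight₁ Y ≤ 3 / 2 * omegaSim S 1 + 5 / 2 * Real.log (primesProd S) := by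
    have := (le_max_right _ _).trans hMordell; linarith
  -- `h(y) ≤ 2h(Y) + 3h(w)`
  have hyY : y = Y ^ 2 / (w : ℚ) ^ 3 := by rw [hY, hyw]; field_simp
  have hhy : logHeight₁ y ≤ 2 * logHeight₁ Y + 3 * logHeight₁ (w : ℚ) := by
    have h1 := logHeight₁_mul_le (Y ^ 2) (((w : ℚ) ^ 3)⁻¹)
    rw [← div_eq_mul_inv, ← hyY, logHeight₁_inv, logHeight₁_pow, logHeight₁_pow] at h1
    push_cast at h1; linarith
  have hyb : logHeight₁ y ≤ 3 * omegaSim S 1 + 9 * Real.log (primesProd S) := by linarith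
  -- `h(n) ≤ h(y)` since `gcd(n, M) = 1`
  have hcop : IsCoprime n M := by
    rw [Int.isCoprime_iff_gcd_eq_one]
    by_contra hg
    obtain ⟨p, hp, hpg⟩ := Nat.exists_prime_and_dvd hg
    have hpn : (p : ℤ) ∣ n := (Int.natCast_dvd_natCast.mpr hpg).trans (Int.gcd_dvd_left _ _)
    have hpM : (p : ℤ) ∣ M := (Int.natCast_dvd_natCast.mpr hpg).trans (Int.gcd_dvd_right _ _)
    have hp3m : (p : ℤ) ^ 3 ∣ m := hmeq ▸ (pow_dvd_pow_of_dvd hpM 3).mul_right m₀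
    have hpl : (p : ℤ) ∣ l := by
      have : (p : ℤ) ∣ l ^ 3 := by
        rw [hl]; exact dvd_add (dvd_trans (dvd_pow_self _ three_ne_zero) hp3m) hpn
      exact (Nat.prime_iff_prime_int.mp hp).dvd_of_dvd_pow this
    have hp3n : (p : ℤ) ^ 3 ∣ n := by
      have : (p : ℤ) ^ 3 ∣ m + n := hl ▸ pow_dvd_pow_of_dvd hpl 3
      exact (dvd_add_right hp3m).mp this
    exact hcf p hp ⟨hp3m, hp3n⟩
  have hM3 : (0 : ℤ) < M ^ 3 := by positivity
  have hyeq : logHeight₁ y = Real.log ((max |n| (M ^ 3) : ℤ) : ℝ) := by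
    rw [hy, ← MurtyPasten.logHeight₁_div_eq hM3 (hcop.pow_right (n := 3))]; push_cast; ring_nf
  have hnle : logHeight₁ (n : ℚ) ≤ logHeight₁ y := by
    rw [hyeq, logHeight₁_intCast_eq' hn0]
    refine Real.log_le_log (abs_pos.mpr (by exact_mod_cast hn0)) ?_
    have : |n| ≤ max |n| (M ^ 3) := le_max_left _ _
    have h' : ((|n| : ℤ) : ℝ) ≤ ((max |n| (M ^ 3) : ℤ) : ℝ) := by exact_mod_cast this
    rwa [Int.cast_abs] at h'
  exact hnle.trans hyb

/-! ### Corollary 9.3 (ii) and Corollary 9.3 from the roots -/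

/-- **vKM Corollary 9.3 (ii) ⟸ Prop. 10.1** (PROVED; `Ω' = 3Ω_sim(1, S) + 9 log N_S`): *"If `u + v` is a cube in
`ℚ`, then there is `δ ∈ 𝒪^×` such that `h(δ³u), h(δ³v) ≤ Ω`."* [cite: VonkanelMatschke2023, Cor. 9.3 (ii) (arXiv §9, cor:sumsofunits)] -/
theorem corollary_9_3_ii_of_mordell_height_le (hMo : mordell_height_le) {S : Finset ℕ}
    (hS : ∀ p ∈ S, p.Prime) {u v : ℚ} (hu : IsSUnit S u) (hv : IsSUnit S v) (hcube : ∃ r : ℚ, u + v = r ^ 3) :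
    ∃ δ : ℚ, IsSUnit S δ ∧
      max (logHeight₁ (δ ^ 3 * u)) (logHeight₁ (δ ^ 3 * v)) ≤
        3 * omegaSim S 1 + 9 * Real.log (primesProd S) := by
  obtain ⟨δ, m, n, hδS, hm, hn, hmS, hnS, hcf⟩ := exists_isSUnit_cube_mul_pair hS hu hv
  obtain ⟨r, hr⟩ := hcube
  -- `m + n = (δ r)³`, and `δ r ∈ ℤ`
  have hsum : ((m + n : ℤ) : ℚ) = (δ * r) ^ 3 := by push_cast; rw [← hm, ← hn, ← mul_add, hr]; ring
  obtain ⟨l, hl⟩ : ∃ l : ℤ, δ * r = l := by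
    by_cases h0 : δ * r = 0
    · exact ⟨0, by rw [h0]; simp⟩
    · refine exists_intCast_of_padicValRat_nonneg fun p hp => ?_
      haveI : Fact p.Prime := ⟨hp⟩
      have h1 : 0 ≤ padicValRat p ((δ * r) ^ 3) := by
        rw [← hsum, padicValRat.of_int]; exact_mod_cast Nat.zero_le _
      rw [padicValRat.pow] at h1
      push_cast at h1; omega
  have hl3 : l ^ 3 = m + n := by
    have : ((l ^ 3 : ℤ) : ℚ) = ((m + n : ℤ) : ℚ) := by rw [hsum, hl]; push_cast; ring
    exact_mod_cast this
  have h1 := claimcube hMo hS hmS hnS hl3 hcf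
  have h2 := claimcube hMo hS hnS hmS (by rw [hl3, add_comm]) fun p hp h => hcf p hp ⟨h.2, h.1⟩
  refine ⟨δ, hδS, ?_⟩
  rw [hm, hn]
  exact max_le h2 h1

/-- **vKM Corollary 9.3 (with `Ω_sim`) ⟸ {Corollary 9.1 (sim), Prop. 10.1}**.
[cite: VonkanelMatschke2023, Cor. 9.3 (arXiv §9, cor:sumsofunits)] -/
theorem corollary_9_3_sim_of_corollary_9_1_sim_of_mordell_height_le (h91 : corollary_9_1_sim)
    (hMo : mordell_height_le) : corollary_9_3_sim := by
  intro S hS u v hu hv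
  exact ⟨fun hsq => corollary_9_3_i_of_corollary_9_1_sim h91 hS hu hv hsq,
    fun hcube => corollary_9_3_ii_of_mordell_height_le hMo hS hu hv hcube⟩

/-- **vKM Corollary 9.3 (with `Ω_sim`) ⟸ {modularity, Lemma 10.3, Prop. 10.8 (i)}** (through
`corollary_9_1_sim_of_roots` and `mordell_height_le_of_lemma_10_3_of_prop_10_8_i`); the named fact
`corollary_9_3_sim` is no longer an independent root. [cite: VonkanelMatschke2023, Cor. 9.3 (arXiv §9, cor:sumsofunits)] -/
theorem corollary_9_3_sim_of_roots (hmod : nonempty_modularParametrizationData)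
    (h103 : vonKanelMatschke_lemma_10_3) (hi : vonKanelMatschke_prop_10_8_i) : corollary_9_3_sim :=
  corollary_9_3_sim_of_corollary_9_1_sim_of_mordell_height_le (corollary_9_1_sim_of_roots hmod h103 hi)
    (mordell_height_le_of_lemma_10_3_of_prop_10_8_i hmod h103 hi)

end VonKanelMatschke

end Literature.NumberTheory.DiophantineGeometry

end
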